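import Summits.KontsevichZagierPeriods.KontsevichZagierPeriods.Theses.LinkTwistWrithe
import Summits.KontsevichZagierPeriods.KontsevichZagierPeriods.Theorems.HurwitzMicroSectorsNormalFormPrincipleSplitGlue

/-!
# `DegreeKernel` (stmt-KontsevichZagierPeriods-4303, route LinkTwistWrithe) — line `pi_cut`
# (crux-strategist ALTERNATIVE line; the live skeleton `Lines/birth.lean` is untouched)

Idea `pi-cut` = the `[π]`-LOCALISATION CUT of the crux, i.e. the strategist's DECOMPOSITION read as a
skeleton: the crux `∀ c, KZ.eval c = 0 → c ∈ R'` (`R' = closure ((1a) ∪ (1b) ∪ (3) ∪ degreeRel)`) is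
RESTATED (summit-equivalent modulo one-sheet absorption and the engine `DegreeTransfer`), and the
qualifying redirect (BC2) is onto the two SHARED, STAFFED items of route AyoubSpecialisation's split of
Conjecture 1 along `[π]` (Kontsevich–Zagier 2001 §4.1 `P̂ = P[(2πi)⁻¹]`; Ayoub 2014 Def. 6 / Conj. 7):

* `stub_piLocalKernel` — VERBATIM the statement of item stmt-KontsevichZagierPeriods-0541
  (`AyoubPiLocalKernel`, wanted by 8 routes; its own lines live under `Cruxes/AyoubPiLocalKernel/` and
  `Cruxes/MultiCoVKernel/Lines/picut_localkernel_birth.lean`): for every pinned product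
  `P n r = [closed unit disc] ⋆ r`, every `c ∈ ker eval` has `(lift (of ∘ P))^[N] c ∈ KZ.relations`
  for some `N`. ALL the transcendence content (GPC-strength: with π-cancellation it gives the
  algebraic independence of `ζ(3), ζ(5), …`, Ayoub 2014 Cor. 32).
* `stub_piCancellation` — VERBATIM the statement of item stmt-KontsevichZagierPeriods-0540
  (`AyoubPiCancellation`, wanted by 10 routes; lines under `Cruxes/AyoubPiCancellation/`,
  `Cruxes/MultiCoVKernel/Lines/picut_cancellation_birth.lean`; substantial partial progress landed as
  `Theorems/LiouvilleUnfoldingAyoubPiCancellation*.lean`): `P`-multiplication reflects relations.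
  Transcendence-free; the effective-versus-localised seam (Huber–Wüstholz 2022 App. A.4, open in print).

Composition (sorry-free): `changeOfVariablesRel_subset_degreeRel` (rule (2) IS the one-sheet
signed-degree relator — the statement of `stub_oneSheet` of line `birth`, PROVED here),
`relations_le_enlargedRelations` (`KZ.relations ≤ R'`), a pinned product exists
(`HurwitzMicroSectors.NormalFormPrincipleSplitGlue.exists_pinnedProduct`, landed), π-peeling by
induction on `N`, and `DegreeKernel_of : DegreeKernel` concludes the crux BY NAME. The same proof,
with the stubs replaced by the items 0541 / 0540 by name, is `Cruxes/DegreeKernel/Split.lean`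
(`DegreeKernel_of_subs`, evidence on 4303) — the glue of the route-level split.

Why it dodges the STUCK goal of line `birth`: `birth`'s open stub `stub_foldedVolumeKernel` (the volume
conjecture for compact bodies in `R'`) has no infrastructure, no sibling and no staffed item behind it;
`pi_cut`'s two stubs ARE the programme's shared leaves for every restated kernel crux (MultiCoVKernel
2873, LogKernelConjecture 2837, NormalFormPrinciple 3869, OffTetraSectorKernel, KernelModuloPeriodConjecture),
so work on them is counted once and inherited here. Honest status: `stub_piLocalKernel` is of
period-conjecture strength (as some stub must be: the crux is); neither stub alone is known to give the
crux or the summit (strategist probes, folder `bc/probes_mustfail.lean`; MultiCoVKernel census: 20/20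
probes fail for the same two statements against the summit), and modulo `DegreeTransfer` the cut is
EXACT (`DegreeKernel ∧ DegreeTransfer → S → 0541 ∧ 0540`, route `closes` + landed
`summit_iff_ayoubPiLocalKernel_and_ayoubPiCancellation`).

Disproof used: none on file (no `Cruxes/DegreeKernel/Disproof.lean`; negatives index: one unrelated
statement, KinematicFormulas 5394). Registration: published with `ledger crux write` only — the CLI has
no `--alt` registration and `ledger skeleton check` would replace the live `birth` registration, which a
strategist must not do; a lead may register this file at a cycle boundary
(`ledger skeleton check $(ledger crux dir stmt-KontsevichZagierPeriods-4303)/Lines/pi_cut.lean --crux stmt-KontsevichZagierPeriods-4303`).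
-/

set_option linter.dupNamespace false

noncomputable section

namespace Summit.KontsevichZagierPeriods.KontsevichZagierPeriods.Cruxes.DegreeKernel.PiCut

open Set MeasureTheory
open Literature.NumberTheory.Transcendental
open Summit.KontsevichZagierPeriods.KontsevichZagierPeriods.Theses.LinkTwistWrithe (DegreeKernel)

/-! ## The enlarged calculus `R'` (verbatim from the crux) -/

/-- The SIGNED-DEGREE RELATORS (fourth generator set of the route's enlarged calculus), copied
verbatim from the body of `DegreeKernel`: finite families of `ℚ`-semialgebraic sheets `σ k ⊆ r.domain`
(co-null union), injective differentiable `ℚ`-semialgebraic maps `Φ k` into `r'.domain` with integer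
weights `ε k` and a.e.-constant signed sheet count `d`, the integrand identity
`r.integrand = Σ_k 1_{σ k} · ε k · (r'.integrand ∘ Φ k) · |det Φ' k|`, and the relator `[r] − d • [r']`.
[cite: KontsevichZagier2001, §1.2 rule (2)] -/
def degreeRel : Set KZ.FormalRep :=
  {c | ∃ (n N : ℕ) (d : ℤ) (ε : Fin N → ℤ) (r r' : Literature.NumberTheory.Transcendental.KZ.IntegralRep n) (σ : Fin N → Set (Fin n → ℝ)) (Φ : Fin N → (Fin n → ℝ) → (Fin n → ℝ)) (Φ' : Fin N → (Fin n → ℝ) → ((Fin n → ℝ) →L[ℝ] (Fin n → ℝ))), (∀ k, Literature.ModelTheory.ExponentialFields.IsSemialgebraic ℚ (σ k)) ∧ (∀ k, σ k ⊆ r.domain) ∧ MeasureTheory.volume (r.domain \ ⋃ k, σ k) = 0 ∧ (∀ k, Literature.NumberTheory.Transcendental.IsSemialgebraicMapOn ℚ (σ k) (Φ k)) ∧ (∀ k, ∀ x ∈ σ k, HasFDerivWithinAt (Φ k) (Φ' k x) (σ k) x) ∧ (∀ k, Set.InjOn (Φ k) (σ k)) ∧ (∀ k, Φ k '' σ k ⊆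 r'.domain) ∧ (∀ᵐ y ∂(MeasureTheory.volume.restrict r'.domain), (∑ k : Fin N, (Φ k '' σ k).indicator (fun _ => ε k) y) = d) ∧ (∀ x ∈ ⋃ k, σ k, r.integrand x = ∑ k : Fin N, (σ k).indicator (fun y => (ε k : ℝ) * (r'.integrand (Φ k y) * |(Φ' k y).det|)) x) ∧ c = Literature.NumberTheory.Transcendental.KZ.of r - d • Literature.NumberTheory.Transcendental.KZ.of r'}

/-- The relation subgroup `R'` of the enlarged calculus: generated by (1a), (1b), (3) and the
signed-degree relators. [cite: KontsevichZagier2001, §1.2] -/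
def enlargedRelations : AddSubgroup KZ.FormalRep :=
  AddSubgroup.closure (KZ.domainAddRel ∪ KZ.integrandAddRel ∪ KZ.newtonLeibnizRel ∪ degreeRel)

/-! ## Rule (2) is the one-sheet signed-degree relator -/

/-- **Rule (2) is the one-sheet signed-degree relator** (the registered stub `stub_oneSheet` of line
`Lines/birth.lean` of this crux, same statement): a `changeOfVariablesRel` instance `(r, r', Φ, Φ')`
is the degree datum with `N = 1`, the single sheet `σ 0 = r.domain` (semialgebraic, exhausting the
domain), the map `Φ` (semialgebraic, differentiable within the sheet, injective), image
`Φ '' r.domain = r'.domain`, weight `ε 0 = 1`, signed count `d = 1` on all of `r'.domain` (hence a.e.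
for `volume.restrict r'.domain`, the domain being measurable), integrand identity
`f = 1 · (f' ∘ Φ) · |det Φ'|` on the sheet, and `[r] − (1 : ℤ) • [r'] = [r] − [r']`.
[cite: KontsevichZagier2001, §1.2 rule (2)] -/
theorem changeOfVariablesRel_subset_degreeRel : KZ.changeOfVariablesRel ⊆ degreeRel := by
  rintro c ⟨n, r, r', Φ, Φ', hsa, hder, hinj, hdom, hf, rfl⟩
  refine ⟨n, 1, 1, fun _ => 1, r, r', fun _ => r.domain, fun _ => Φ, fun _ => Φ',
    ?_, ?_, ?_, ?_, ?_, ?_, ?_, ?_, ?_, ?_⟩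
  · intro _; exact r.isSemialgebraic_domain
  · intro _; exact Subset.rfl
  · simp [Set.iUnion_const]
  · intro _; exact hsa
  · intro _ x hx; exact hder x hx
  · intro _; exact hinj
  · intro _; rw [hdom]
  · refine ae_restrict_of_forall_mem (KZ.IntegralRep.measurableSet_domain_holds r') fun y hy => ?_
    have hy' : y ∈ Φ '' r.domain := hdom ▸ hy
    simp [Set.indicator_of_mem hy']
  · intro x hx
    have hx' : x ∈ r.domain := by simpa [Set.iUnion_const] using hx
    simp [Set.indicator_of_mem hx', hf x hx']
  · simp

/-- **Every KZ relation is an `R'` relation**: (1a), (1b), (3) are generators of both, and rule (2)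
is the one-sheet signed-degree relator (`changeOfVariablesRel_subset_degreeRel`).
[cite: KontsevichZagier2001, §1.2] -/
theorem relations_le_enlargedRelations : KZ.relations ≤ enlargedRelations := by
  refine (AddSubgroup.closure_le _).mpr ?_
  rintro c (((hc | hc) | hc) | hc)
  · exact AddSubgroup.subset_closure (Or.inl (Or.inl (Or.inl hc)))
  · exact AddSubgroup.subset_closure (Or.inl (Or.inl (Or.inr hc)))
  · exact AddSubgroup.subset_closure (Or.inr (changeOfVariablesRel_subset_degreeRel hc))
  · exact AddSubgroup.subset_closure (Or.inl (Or.inr hc))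

/-! ## The two stubs (verbatim the shared items 0541 / 0540) -/

/-- Stub 1 — π-LOCAL KERNEL, verbatim item stmt-KontsevichZagierPeriods-0541 (`AyoubPiLocalKernel` of
route AyoubSpecialisation; shared). Conjecture 1 for the effective period ring localised at `[π]`,
transcribed to the four moves with a pinned product `P n r = [closed unit disc] ⋆ r`. OPEN,
GPC-strength; why it might fail: torsor/motivic methods give relations in Nori's/Ayoub's presentation
only and their transfer into the four moves (even with `[π]` inverted) is unproved. Sources: Ayoub2014
Def. 6 / Conj. 7 / Cor. 32; KontsevichZagier2001 §4.1; HuberMullerStachPeriods2017 Prop. 13.2.6.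
[cite: Ayoub2014, Def. 6 and Conj. 7] -/
theorem stub_piLocalKernel : ∀ (P : ∀ n : ℕ, Literature.NumberTheory.Transcendental.KZ.IntegralRep n → Literature.NumberTheory.Transcendental.KZ.IntegralRep (n + 2)), (∀ (n : ℕ) (r : Literature.NumberTheory.Transcendental.KZ.IntegralRep n), (P n r).domain = {z : Fin (n + 2) → ℝ | z 0 ^ 2 + z 1 ^ 2 ≤ 1 ∧ (fun i : Fin n => z i.succ.succ) ∈ r.domain} ∧ (P n r).integrand = fun z => r.integrand (fun i : Fin n => z i.succ.succ)) → ∀ c : Literature.NumberTheory.Transcendental.KZ.FormalRep, Literature.NumberTheory.Transcendental.KZ.eval c = 0 → ∃ N : ℕ, (⇑(FreeAbelianGroup.lift (fun s : (Σ n, Literature.NumberTheory.Transcendental.KZ.IntegralRep n) => Literature.NumberTheory.Transcendental.KZ.of (P s.1 s.2))))^[N] c ∈ Literature.NumberTheory.Transcendental.KZ.relations := by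
  sorry

/-- Stub 2 — π-CANCELLATION, verbatim item stmt-KontsevichZagierPeriods-0540 (`AyoubPiCancellation` of
route AyoubSpecialisation; shared). `[π]` is a non-zero-divisor on `FormalRep ⧸ relations`. OPEN,
transcendence-free; why it might fail: a certificate for `[π] ⋆ c` may mix the disc coordinates with
`c`'s (carrier migration), and the motivic shadow `P̃(MM^eff_Nori) → P̃(MM_Nori)` injective is printed
open (HuberWustholz2022 App. A.4); one witness refutes the summit (item 0542). Sources:
HuberWustholz2022 App. A.4; AyoubRelKZRevisited Rem. 1.3; KontsevichZagier2001 §4.1.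
[cite: HuberWustholz2022, App. A.4] -/
theorem stub_piCancellation : ∀ (P : ∀ n : ℕ, Literature.NumberTheory.Transcendental.KZ.IntegralRep n → Literature.NumberTheory.Transcendental.KZ.IntegralRep (n + 2)), (∀ (n : ℕ) (r : Literature.NumberTheory.Transcendental.KZ.IntegralRep n), (P n r).domain = {z : Fin (n + 2) → ℝ | z 0 ^ 2 + z 1 ^ 2 ≤ 1 ∧ (fun i : Fin n => z i.succ.succ) ∈ r.domain} ∧ (P n r).integrand = fun z => r.integrand (fun i : Fin n => z i.succ.succ)) → ∀ c : Literature.NumberTheory.Transcendental.KZ.FormalRep, FreeAbelianGroup.lift (fun s : (Σ n, Literature.NumberTheory.Transcendental.KZ.IntegralRep n) => Literature.NumberTheory.Transcendental.KZ.of (P s.1 s.2)) c ∈ Literature.NumberTheory.Transcendental.KZ.relations → c ∈ Literature.NumberTheory.Transcendental.KZ.relations := by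
  sorry

/-! ## The composition (sorry-free) -/

/-- Arrow form of the composition: π-local kernel → π-cancellation → the crux UNFOLDED. A pinned
product exists (`exists_pinnedProduct`, landed, so neither `∀ P`-hypothesis is used vacuously); for
`c ∈ ker eval` stub 1 gives `(lift (of ∘ P))^[N] c ∈ KZ.relations`, stub 2 peels the `N` factors
(induction on `N`), and `relations_le_enlargedRelations` (rule (2) is the one-sheet signed-degree
relator) moves `c ∈ KZ.relations` into `R'`. [cite: Ayoub2014, Def. 6 and Conj. 7] -/
theorem degreeKernel_of_stubs
    (h₁ : ∀ (P : ∀ n : ℕ, Literature.NumberTheory.Transcendental.KZ.IntegralRep n → Literature.NumberTheory.Transcendental.KZ.IntegralRep (n + 2)), (∀ (n : ℕ) (r : Literature.NumberTheory.Transcendental.KZ.IntegralRep n), (P n r).domain = {z : Fin (n + 2) → ℝ | z 0 ^ 2 + z 1 ^ 2 ≤ 1 ∧ (fun i : Fin n => z i.succ.succ) ∈ r.domain} ∧ (P n r).integrand = fun z => r.integrand (fun i : Fin n => z i.succ.succ)) → ∀ c : Literature.NumberTheory.Transcendental.KZ.FormalRep, Literature.NumberTheory.Transcendental.KZ.eval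 c = 0 → ∃ N : ℕ, (⇑(FreeAbelianGroup.lift (fun s : (Σ n, Literature.NumberTheory.Transcendental.KZ.IntegralRep n) => Literature.NumberTheory.Transcendental.KZ.of (P s.1 s.2))))^[N] c ∈ Literature.NumberTheory.Transcendental.KZ.relations)
    (h₂ : ∀ (P : ∀ n : ℕ, Literature.NumberTheory.Transcendental.KZ.IntegralRep n → Literature.NumberTheory.Transcendental.KZ.IntegralRep (n + 2)), (∀ (n : ℕ) (r : Literature.NumberTheory.Transcendental.KZ.IntegralRep n), (P n r).domain = {z : Fin (n + 2) → ℝ | z 0 ^ 2 + z 1 ^ 2 ≤ 1 ∧ (fun i : Fin n => z i.succ.succ) ∈ r.domain} ∧ (P n r).integrand = fun z => r.integrand (fun i : Fin n => z i.succ.succ)) → ∀ c : Literature.NumberTheory.Transcendental.KZ.FormalRep, FreeAbelianGroup.lift (fun s : (Σ n, Literature.NumberTheory.Transcendental.KZ.IntegralRep n) => Literature.NumberTheory.Transcendental.KZ.of (P s.1 s.2)) c ∈ Literature.NumberTheory.Transcendental.KZ.relations → c ∈ Literature.NumberTheory.Transcendental.KZ.relations) :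
    ∀ c : KZ.FormalRep, KZ.eval c = 0 → c ∈ enlargedRelations := by
  obtain ⟨P, hP⟩ :=
    Summit.KontsevichZagierPeriods.HurwitzMicroSectors.NormalFormPrincipleSplitGlue.exists_pinnedProduct
  intro c hc
  obtain ⟨N, hN⟩ := h₁ P hP c hc
  have hrel : c ∈ KZ.relations := by
    clear hc
    induction N with
    | zero => simpa using hN
    | succ N ih =>
      exact ih (h₂ P hP _ (by simpa only [Function.iterate_succ_apply'] using hN))
  exact relations_le_enlargedRelations hrel

/-- **The skeleton theorem** (concludes the crux BY NAME; sorries enter only through the two named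
stubs `stub_piLocalKernel`, `stub_piCancellation`). [cite: Ayoub2014, Def. 6 and Conj. 7] -/
theorem DegreeKernel_of : DegreeKernel :=
  degreeKernel_of_stubs stub_piLocalKernel stub_piCancellation

end Summit.KontsevichZagierPeriods.KontsevichZagierPeriods.Cruxes.DegreeKernel.PiCut

end
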